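import Summits.BirchSwinnertonDyer.BirchSwinnertonDyer.Theorems.KimAtThreeDeepLowerOffStratumLevelLoweringDoubleStabConditionOne
import Literature.NumberTheory.EllipticCurves.NewformsOldHeckeStableProofs
import HarnessLib

/-!
# Route `KimAtThreeKolyvagin` (rung W2), crux `DeepLowerAtThreeOffKatoStratum` (item 19679), registered
# stub `stub_nonAdditive`, ROAD (b^k): Vatsal's Condition 1 is INHERITED by ONE MORE stabilisation
# (the induction step of the `k`-fold stabilisation of the optimal-level newform)

Cell `bsd-addord`, seat `bsd-addord-w2-acc2` (PROGRAMME PART 1b, ACCEL-LIST row (2)), gen 6; item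
`stmt-BirchSwinnertonDyer-19679` (OWNER w2-c2 assembles; `--supports`, closes nothing). Gen 5 closed the semistable
depth-`1` rows of the stub with at most ONE extra unramified prime (`…RibetRowsAllPrimes`, `…DoubleStabRowsFinal`);
the 871 rows with `≥ 2` extra unramified primes need the comparison form for Vatsal's congruence to be the `k`-FOLD
stabilisation of the optimal-level newform `g`, built one prime at a time. `…ConditionOne` §2 (one prime, from a
newform) and `…DoubleStabConditionOne` (two primes, the four double stabilisations written out) do not iterate; THIS
FILE proves the INDUCTION STEP: if `G ∈ S₂(Γ₀(N))` is a normalised Hecke eigenform in the Hecke family of a newform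
`g ∈ S₂(Γ₀(M₀))` (`M₀ ∣ N`, `a_p(G) = a_p(g)` for `p ∤ N`) satisfying Condition 1, and `ℓ ∤ N` is a prime with
`β² − a_ℓ(G)β + ℓ = 0`, `α = a_ℓ(G) − β ≠ β`, then `G′ = ι₁ G − β ι_ℓ G ∈ S₂(Γ₀(Nℓ))` satisfies Condition 1.
Mechanism: a generalised eigenvector `k` for the eigencharacter of `G′` is an honest `T_p`-eigenvector off `Nℓ`
(`heckeT_apply_eq_smul_of_pow_apply_eq_zero`), hence (Atkin–Lehner basis + strong multiplicity one) a combination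
of the old forms `ι_d g`, `M₀ d ∣ Nℓ`; these are `ι₁ v`, `ι_ℓ v` with `v` in the `T_ℓ`-eigenspace `V ⊆ S₂(Γ₀(N))`
for `a_ℓ(g)` (`heckeT_iota_of_not_dvd`), and `ι₁ V + ι_ℓ V = S_β V ⊕ S_α V` with `S_t = ι₁ − t ι_ℓ`,
`U_ℓ S_β v = α S_β v`, `U_ℓ S_α v = β S_α v` (Diamond–Shurman Prop. 5.6.2: `U_ℓ ι₁ = ι₁ T_ℓ − ℓ ι_ℓ`,
`U_ℓ ι_ℓ = ι₁`); a power of `U_ℓ − α` kills the `S_α`-component, `S_β` is injective and commutes with `T_p − λ`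
(`p ≠ ℓ`), so `k = S_β w` with `w` a generalised eigenvector for `G` at level `N`, i.e. `w ∈ ℂ G`.
Theorems only; no definition, no fact, no `sorry`.

* §1 `pow_sub_smul_one_apply_comm`, `eq_zero_of_stab_eq_zero` (injectivity of `ι₁ − t ι_ℓ`),
  `heckeT_stab_self_of_heckeT_eq_smul` (`U_ℓ` on the stabilisation of a `T_ℓ`-eigenvector), `heckeT_stab_comm`.
* §2 ★ `hasSimpleHeckeGenEigenspace_stab_of_hasSimpleHeckeGenEigenspace` — the induction step.

## References

* V. Vatsal, Duke Math. J. 98 (1999), (1.2) Condition 1. [Vatsal1999]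
* A. O. L. Atkin, J. Lehner, Math. Ann. 185 (1970), Thm. 4, Thm. 5. [AtkinLehner1970]
* F. Diamond, J. Shurman (2005), Prop. 5.6.2, Thm. 5.8.3. [DiamondShurman2005]
-/

set_option autoImplicit false
-- the Theorems namespace of a single-conjunct summit repeats the summit name by design (D-0017)
set_option linter.dupNamespace false

noncomputable section

open scoped MatrixGroups ModularForm Classical NNReal

open CongruenceSubgroup WeierstrassCurve Literature.NumberTheory.EllipticCurves
  Literature.NumberTheory.EllipticCurves.ModularForms
open UpperHalfPlane hiding I

namespace Summit.BirchSwinnertonDyer.BirchSwinnertonDyer.Theorems.KimAtThreeDeepLowerOffStratumLevelLoweringMultiStabConditionOne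

open Summit.BirchSwinnertonDyer.BirchSwinnertonDyer.Theorems.KimAtThreeDeepLowerOffStratumLevelLoweringConditionOne
open Summit.BirchSwinnertonDyer.BirchSwinnertonDyer.Theorems.KimAtThreeDeepLowerOffStratumLevelLoweringVatsalStab
  (cuspCoeff_stab isNormalized_stab)
open Summit.BirchSwinnertonDyer.BirchSwinnertonDyer.Theorems.KimAtThreeDeepLowerOffStratumLevelLoweringStabEigenform
  renaming heckeT_stab_of_ne → heckeT_stab_of_ne_eig, heckeT_stab_self → heckeT_stab_self_eig,
    isHeckeEigenform_stab → isHeckeEigenform_stab_eig, cuspCoeff_stab_prime → cuspCoeff_stab_prime_eig,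
    cuspCoeff_mul_cuspCoeff → cuspCoeff_mul_cuspCoeff_eig, heckeEigenvalue_stab → heckeEigenvalue_stab_eig
open Summit.BirchSwinnertonDyer.BirchSwinnertonDyer.Theorems.KimAtThreeDeepLowerOffStratumLevelLoweringDoubleStabConditionOne
  (iota_iota)

/-! ### §1 The stabilisation map `S_t = ι₁ − t ι_ℓ : S₂(Γ₀(N)) → S₂(Γ₀(Nℓ))` on `T_ℓ`-eigenvectors -/

section Operators

/-- Powers of `T′ − c` and `T − c` are intertwined by any linear `S` intertwining `T′` and `T`. [folklore] -/
theorem pow_sub_smul_one_apply_comm {V W : Type*} [AddCommGroup V] [Module ℂ V] [AddCommGroup W] [Module ℂ W]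
    (S : V →ₗ[ℂ] W) (T : Module.End ℂ V) (T' : Module.End ℂ W) (hc : ∀ v, T' (S v) = S (T v)) (c : ℂ) (n : ℕ)
    (v : V) :
    ((T' - c • (1 : Module.End ℂ W)) ^ n) (S v) = S (((T - c • (1 : Module.End ℂ V)) ^ n) v) := by
  induction n generalizing v with
  | zero => rw [pow_zero, pow_zero, Module.End.one_apply, Module.End.one_apply]
  | succ n ih =>
    have e : (T' - c • (1 : Module.End ℂ W)) (S v) = S ((T - c • (1 : Module.End ℂ V)) v) := by
      rw [LinearMap.sub_apply, LinearMap.smul_apply, Module.End.one_apply, hc, LinearMap.sub_apply,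
        LinearMap.smul_apply, Module.End.one_apply, map_sub, map_smul]
    rw [pow_succ, pow_succ, Module.End.mul_apply, Module.End.mul_apply, e, ih]

variable {N ℓ : ℕ} [NeZero ℓ] (h1 : N * 1 ∣ N * ℓ) (hℓℓ : N * ℓ ∣ N * ℓ)

/-- **`S_t = ι₁ − t ι_ℓ` is injective** on `S₂(Γ₀(N))` (`ℓ` prime): `aₙ(S_t w) = aₙ(w) − t·𝟙_{ℓ∣n} a_{n/ℓ}(w)`, so
`S_t w = 0` forces `aₙ(w) = 0` by strong induction on `n` (`a₀(w) = 0` for a cusp form).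
[cite: DiamondShurman2005, §5.7 (ι_d on Fourier expansions)] -/
theorem eq_zero_of_stab_eq_zero (hℓ : ℓ.Prime) (w : CuspForm (Gamma0 N) 2) (t : ℂ)
    (h : iota N (N * ℓ) 1 2 h1 w - t • iota N (N * ℓ) ℓ 2 hℓℓ w = 0) : w = 0 := by
  have hco : ∀ n : ℕ, cuspCoeff w n = t * (if ℓ ∣ n then cuspCoeff w (n / ℓ) else 0) := by
    intro n
    have e := congrArg (fun φ : CuspForm (Gamma0 (N * ℓ)) 2 ↦ cuspCoeff φ n) (sub_eq_zero.mp h)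
    simp only [cuspCoeff, qExpansion_coeff_smul, qExpansion_coeff_iota, one_dvd, if_true, Nat.div_one] at e
    exact e
  refine eq_zero_of_qExpansion_coeff_eq_zero_level0 w fun n ↦ ?_
  induction n using Nat.strong_induction_on with
  | _ n ih =>
    rcases Nat.eq_zero_or_pos n with rfl | hn
    · exact CuspFormClass.qExpansion_coeff_zero w one_pos (one_mem_strictPeriods_gamma0 N)
    · have e := hco n
      rw [cuspCoeff] at e
      rw [e]
      by_cases hℓn : ℓ ∣ n
      · rw [if_pos hℓn, cuspCoeff, ih (n / ℓ) (Nat.div_lt_self hn hℓ.one_lt), mul_zero]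
      · rw [if_neg hℓn, mul_zero]

/-- **`U_ℓ S_t v = (a − t)·S_t v`** for a `T_ℓ`-eigenvector `v ∈ S₂(Γ₀(N))` with eigenvalue `a` (`ℓ ∤ N` prime) and a
root `t` of `X² − aX + ℓ`: `U_ℓ ι₁ = ι₁ T_ℓ − ℓ ι_ℓ` and `U_ℓ ι_ℓ = ι₁` (Diamond–Shurman Prop. 5.6.2, second diagram).
[cite: DiamondShurman2005, Prop. 5.6.2 (proof, second diagram)] -/
theorem heckeT_stab_self_of_heckeT_eq_smul [NeZero N] (hℓ : ℓ.Prime) (hℓN : ¬ ℓ ∣ N) {v : CuspForm (Gamma0 N) 2} {a t : ℂ}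
    (hv : heckeT (Gamma0 N) 2 ℓ v = a • v) (ht : t ^ 2 - a * t + ℓ = 0) :
    heckeT (Gamma0 (N * ℓ)) 2 ℓ (iota N (N * ℓ) 1 2 h1 v - t • iota N (N * ℓ) ℓ 2 hℓℓ v) =
      (a - t) • (iota N (N * ℓ) 1 2 h1 v - t • iota N (N * ℓ) ℓ 2 hℓℓ v) := by
  have hℓNℓ : ℓ ∣ N * ℓ := dvd_mul_left ℓ N
  have h2 : N * (1 * ℓ) ∣ N * ℓ := by rw [one_mul]
  have h3 : N * (ℓ * 1) ∣ N * ℓ := by rw [mul_one]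
  have hU1 : heckeT (Gamma0 (N * ℓ)) 2 ℓ (iota N (N * ℓ) 1 2 h1 v) =
      iota N (N * ℓ) 1 2 h1 (heckeT (Gamma0 N) 2 ℓ v) - (ℓ : ℂ) • iota N (N * ℓ) ℓ 2 hℓℓ v := by
    rw [heckeT_iota_of_dvd_of_not_dvd h1 h2 hℓ hℓNℓ hℓN hℓ.not_dvd_one v, iota_congr (one_mul ℓ) h2 hℓℓ v,
      show (2 : ℤ) - 1 = 1 by norm_num, zpow_one]
  have hUℓ : heckeT (Gamma0 (N * ℓ)) 2 ℓ (iota N (N * ℓ) ℓ 2 hℓℓ v) = iota N (N * ℓ) 1 2 h1 v := by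
    rw [← iota_congr (mul_one ℓ) h3 hℓℓ v]
    exact heckeT_iota_mul h3 h1 hℓ hℓNℓ v
  rw [map_sub, map_smul, hU1, hUℓ, hv, map_smul]
  have hℓt : (ℓ : ℂ) = a * t - t ^ 2 := by linear_combination ht
  rw [hℓt]
  module

/-- **`T_p S_t = S_t T_p` for a prime `p ≠ ℓ`** (including `p ∣ N`): `T_p ι_d = ι_d T_p` for `p ∤ d`, `d ∈ {1, ℓ}`.
[cite: DiamondShurman2005, Prop. 5.6.2 (proof, first diagram)] -/
theorem heckeT_stab_comm [NeZero N] (hℓ : ℓ.Prime) {p : ℕ} [NeZero p] (hp : p.Prime) (hpℓ : p ≠ ℓ)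
    (v : CuspForm (Gamma0 N) 2) (t : ℂ) :
    heckeT (Gamma0 (N * ℓ)) 2 p (iota N (N * ℓ) 1 2 h1 v - t • iota N (N * ℓ) ℓ 2 hℓℓ v) =
      iota N (N * ℓ) 1 2 h1 (heckeT (Gamma0 N) 2 p v) - t • iota N (N * ℓ) ℓ 2 hℓℓ (heckeT (Gamma0 N) 2 p v) := by
  have hpℓ' : ¬ p ∣ ℓ := fun h ↦ hpℓ ((Nat.prime_dvd_prime_iff_eq hp hℓ).mp h)
  have hiff : p ∣ N ↔ p ∣ N * ℓ :=
    ⟨fun h ↦ h.mul_right ℓ, fun h ↦ ((Nat.Prime.dvd_mul hp).mp h).resolve_right hpℓ'⟩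
  rw [map_sub, map_smul, heckeT_iota_of_not_dvd h1 hp hp.not_dvd_one hiff, heckeT_iota_of_not_dvd hℓℓ hp hpℓ' hiff]

end Operators

/-! ### §2 The induction step: Condition 1 passes from `G` to `ι₁ G − β ι_ℓ G` -/

section Step

variable {M₀ N ℓ : ℕ} [NeZero M₀] [NeZero N] [NeZero ℓ] {g : CuspForm (Gamma0 M₀) 2} (hg : IsNewform0 g)
  (h1 : N * 1 ∣ N * ℓ) (hℓℓ : N * ℓ ∣ N * ℓ)
include hg

/-- ★ **Condition 1 is inherited by one more stabilisation.** Let `g ∈ S₂(Γ₀(M₀))` be a newform, `M₀ ∣ N`, and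
`G ∈ S₂(Γ₀(N))` a normalised Hecke eigenform with `a_p(G) = a_p(g)` for every prime `p ∤ N` that satisfies
Vatsal's Condition 1 (`HasSimpleHeckeGenEigenspace G`). Let `ℓ ∤ N` be a prime, `β² − a_ℓ(G)β + ℓ = 0` with
`a_ℓ(G) − β ≠ β`. Then `ι₁ G − β ι_ℓ G ∈ S₂(Γ₀(Nℓ))` satisfies Condition 1. (Base cases: `G = g`, `N = M₀` is
`…ConditionOne.hasSimpleHeckeGenEigenspace_of_isNewform0`; one step from there recovers
`…ConditionOne.hasSimpleHeckeGenEigenspace_stab_of_ne`, two steps `…DoubleStabConditionOne`.)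
[cite: Vatsal1999, (1.2) Condition 1] [cite: AtkinLehner1970, Thm. 4 and Thm. 5]
[cite: DiamondShurman2005, Prop. 5.6.2 and Thm. 5.8.3] -/
theorem hasSimpleHeckeGenEigenspace_stab_of_hasSimpleHeckeGenEigenspace (hM₀N : M₀ ∣ N)
    {G : CuspForm (Gamma0 N) 2} (hGeig : IsHeckeEigenform G) (hGnorm : IsNormalized G)
    (hGC : HasSimpleHeckeGenEigenspace G) (hGg : ∀ p : ℕ, p.Prime → ¬ p ∣ N → cuspCoeff G p = cuspCoeff g p)
    (hℓ : ℓ.Prime) (hℓN : ¬ ℓ ∣ N) {β : ℂ} (hβ : β ^ 2 - cuspCoeff G ℓ * β + ℓ = 0) (hne : cuspCoeff G ℓ - β ≠ β) :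
    HasSimpleHeckeGenEigenspace (iota N (N * ℓ) 1 2 h1 G - β • iota N (N * ℓ) ℓ 2 hℓℓ G) := by
  set a : ℂ := cuspCoeff G ℓ with hadef
  set α : ℂ := a - β with hαdef
  have haℓ : a = cuspCoeff g ℓ := hGg ℓ hℓ hℓN
  have hα : α ^ 2 - a * α + ℓ = 0 := by rw [hαdef]; linear_combination hβ
  have hαβ : α - β ≠ 0 := sub_ne_zero.mpr hne
  have hℓM₀ : ¬ ℓ ∣ M₀ := fun h ↦ hℓN (h.trans hM₀N)
  -- the two stabilisation maps `S_β`, `S_α`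
  set Sβ : CuspForm (Gamma0 N) 2 →ₗ[ℂ] CuspForm (Gamma0 (N * ℓ)) 2 :=
    iota N (N * ℓ) 1 2 h1 - β • iota N (N * ℓ) ℓ 2 hℓℓ with hSβ
  set Sα : CuspForm (Gamma0 N) 2 →ₗ[ℂ] CuspForm (Gamma0 (N * ℓ)) 2 :=
    iota N (N * ℓ) 1 2 h1 - α • iota N (N * ℓ) ℓ 2 hℓℓ with hSα
  have hSβv : ∀ v, Sβ v = iota N (N * ℓ) 1 2 h1 v - β • iota N (N * ℓ) ℓ 2 hℓℓ v := fun v ↦ rfl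
  have hSαv : ∀ v, Sα v = iota N (N * ℓ) 1 2 h1 v - α • iota N (N * ℓ) ℓ 2 hℓℓ v := fun v ↦ rfl
  -- the eigenvalues of `G′ = S_β G`
  have hev : ∀ {p : ℕ}, p.Prime → heckeEigenvalue (iota N (N * ℓ) 1 2 h1 G - β • iota N (N * ℓ) ℓ 2 hℓℓ G) p =
      if p = ℓ then a - β else cuspCoeff G p :=
    fun hp ↦ heckeEigenvalue_stab_eig hGeig hGnorm β h1 hℓℓ hℓ hℓN hβ hp
  change ∀ k : CuspForm (Gamma0 (N * ℓ)) 2, _ → ∃ c : ℂ, k = c • Sβ G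
  intro k hk
  by_cases hk0 : k = 0
  · exact ⟨0, by rw [hk0, zero_smul]⟩
  -- off `Nℓ` the generalised eigen-equations are honest, with eigenvalues `a_p(g)`
  have hT : ∀ (p : ℕ) (hp : p.Prime), ¬ p ∣ N * ℓ →
      (haveI : NeZero p := ⟨hp.ne_zero⟩; heckeT (Gamma0 (N * ℓ)) 2 p k) = (qExpansion 1 ⇑g).coeff p • k := by
    intro p hp hpNℓ
    haveI : NeZero p := ⟨hp.ne_zero⟩
    have hpℓ : p ≠ ℓ := by rintro rfl; exact hpNℓ (dvd_mul_left p N)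
    have hpN : ¬ p ∣ N := fun h ↦ hpNℓ (h.mul_right ℓ)
    obtain ⟨n, hn⟩ := hk p hp
    rw [hev hp, if_neg hpℓ, hGg p hp hpN] at hn
    exact heckeT_apply_eq_smul_of_pow_apply_eq_zero hp hpNℓ hn
  obtain ⟨M', _, hM'N, g₁, hg₁, hcoef, hmem⟩ := exists_isNewform0_mem_span_of_eigenpacket hk0 hT
  -- strong multiplicity one: `M' = M₀`, `g₁ = g`
  have hfg : ∀ p : ℕ, p.Prime → ¬ p ∣ N * ℓ → heckeEigenvalue g p = heckeEigenvalue g₁ p := by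
    intro p hp hpN
    rw [heckeEigenvalue_eq_coeff_of_isNormalized hg.2.2 hp (hg.2.1 p hp),
      heckeEigenvalue_eq_coeff_of_isNormalized hg₁.2.2 hp (hg₁.2.1 p hp), hcoef p hp hpN]
  have hfin : {p : ℕ | p.Prime ∧ heckeEigenvalue g p ≠ heckeEigenvalue g₁ p}.Finite :=
    finite_setOf_prime_and_ne (NeZero.ne (N * ℓ)) hfg
  have hMM' : M₀ = M' := IsNewform0.level_eq_of_heckeEigenvalue_eq_holds hg hg₁ hfin
  subst hMM'
  have hg₁g : g₁ = g := (IsNewform0.eq_of_heckeEigenvalue_eq_holds hg hg₁ hfin).symm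
  rw [hg₁g] at hmem
  -- the `T_ℓ`-eigenspace `V ⊆ S₂(Γ₀(N))` for `a = a_ℓ(g)` and the target space `P = S_β V + S_α V`
  set V : Submodule ℂ (CuspForm (Gamma0 N) 2) := Module.End.eigenspace (heckeT (Gamma0 N) 2 ℓ) a with hVdef
  have hV : ∀ {v : CuspForm (Gamma0 N) 2}, v ∈ V ↔ heckeT (Gamma0 N) 2 ℓ v = a • v :=
    Module.End.mem_eigenspace_iff
  set P : Submodule ℂ (CuspForm (Gamma0 (N * ℓ)) 2) := V.map Sβ ⊔ V.map Sα with hPdef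
  have hιℓ : ∀ v ∈ V, iota N (N * ℓ) ℓ 2 hℓℓ v ∈ P := by
    intro v hv
    have he : iota N (N * ℓ) ℓ 2 hℓℓ v = (α - β)⁻¹ • (Sβ v - Sα v) := by
      rw [hSβv, hSαv, sub_sub_sub_cancel_left, ← sub_smul, smul_smul, inv_mul_cancel₀ hαβ, one_smul]
    rw [he]
    exact P.smul_mem _ (P.sub_mem (Submodule.mem_sup_left ⟨v, hv, rfl⟩) (Submodule.mem_sup_right ⟨v, hv, rfl⟩))
  have hι1 : ∀ v ∈ V, iota N (N * ℓ) 1 2 h1 v ∈ P := by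
    intro v hv
    have he : iota N (N * ℓ) 1 2 h1 v = Sβ v + β • iota N (N * ℓ) ℓ 2 hℓℓ v := by rw [hSβv, sub_add_cancel]
    rw [he]
    exact P.add_mem (Submodule.mem_sup_left ⟨v, hv, rfl⟩) (P.smul_mem _ (hιℓ v hv))
  -- the old forms `ι_d g`, `M₀ d ∣ N`, lie in `V`
  have hιV : ∀ {d : ℕ} [NeZero d] (hd : M₀ * d ∣ N), iota M₀ N d 2 hd g ∈ V := by
    intro d _ hd
    have hℓd : ¬ ℓ ∣ d := fun h ↦ hℓN (h.trans ((dvd_mul_left d M₀).trans hd))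
    rw [hV, heckeT_iota_of_not_dvd hd hℓ hℓd ⟨fun h ↦ absurd h hℓM₀, fun h ↦ absurd h hℓN⟩,
      hg.heckeT_eq_coeff_smul hℓ, map_smul, haℓ]
    rfl
  -- the `(Nℓ/M₀)`-old forms of `g` lie in `P`
  have hle : Submodule.span ℂ
      {v | ∃ (d : ℕ) (_ : NeZero d), M₀ * d ∣ N * ℓ ∧ v = degeneracyMap0 M₀ (N * ℓ) d 2 g} ≤ P := by
    refine Submodule.span_le.mpr ?_
    rintro _ ⟨d, _, hd, rfl⟩
    rw [SetLike.mem_coe, degeneracyMap0_eq_smul_iota M₀ (N * ℓ) d 2 hd]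
    refine P.smul_mem _ ?_
    by_cases hℓd : ℓ ∣ d
    · -- `d = ℓ e`, `ℓ ∤ e`, `M₀ e ∣ N`: `ι_d g = ι_ℓ (ι_e g)`
      obtain ⟨e, rfl⟩ := hℓd
      haveI : NeZero e := ⟨fun h ↦ NeZero.ne (ℓ * e) (by rw [h, mul_zero])⟩
      have he : M₀ * e ∣ N :=
        Nat.dvd_of_mul_dvd_mul_right (NeZero.pos ℓ) (by simpa only [mul_comm, mul_assoc, mul_left_comm] using hd)
      have hd' : M₀ * (e * ℓ) ∣ N * ℓ := by simpa only [mul_comm] using hd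
      rw [iota_congr (mul_comm ℓ e) hd hd' g, ← iota_iota (L := M₀) (M := N) (e := e) (d := ℓ) he hℓℓ hd' g]
      exact hιℓ _ (hιV he)
    · -- `ℓ ∤ d`, `M₀ d ∣ N`: `ι_d g = ι₁ (ι_d g)`
      have hcop : Nat.Coprime (M₀ * d) ℓ :=
        Nat.Coprime.mul_left ((Nat.Prime.coprime_iff_not_dvd hℓ).mpr hℓM₀).symm
          ((Nat.Prime.coprime_iff_not_dvd hℓ).mpr hℓd).symm
      have hd' : M₀ * d ∣ N := hcop.dvd_of_dvd_mul_right hd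
      have hd'' : M₀ * (d * 1) ∣ N * ℓ := by rw [mul_one]; exact hd
      rw [iota_congr (mul_one d).symm hd hd'' g, ← iota_iota (L := M₀) (M := N) (e := d) (d := 1) hd' h1 hd'' g]
      exact hι1 _ (hιV hd')
  -- coordinates: `k = S_β w₁ + S_α w₂` with `w₁, w₂ ∈ V`
  obtain ⟨y, hy, z, hz, hyz⟩ := Submodule.mem_sup.mp (hle hmem)
  obtain ⟨w₁, hw₁, rfl⟩ := Submodule.mem_map.mp hy
  obtain ⟨w₂, hw₂, rfl⟩ := Submodule.mem_map.mp hz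
  have hUβ : heckeT (Gamma0 (N * ℓ)) 2 ℓ (Sβ w₁) = α • Sβ w₁ := by
    rw [hSβv]
    exact heckeT_stab_self_of_heckeT_eq_smul h1 hℓℓ hℓ hℓN (hV.mp hw₁) hβ
  have hUα : heckeT (Gamma0 (N * ℓ)) 2 ℓ (Sα w₂) = β • Sα w₂ := by
    rw [hSαv, heckeT_stab_self_of_heckeT_eq_smul h1 hℓℓ hℓ hℓN (hV.mp hw₂) hα, show a - α = β by rw [hαdef]; ring]
  -- a power of `U_ℓ − α` kills `k`: its `S_α`-component vanishes
  obtain ⟨m, hm⟩ := hk ℓ hℓ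
  rw [hev hℓ, if_pos rfl] at hm
  rcases Nat.eq_zero_or_pos m with rfl | hmpos
  · rw [pow_zero, Module.End.one_apply] at hm
    exact absurd hm hk0
  have hSα0 : Sα w₂ = 0 := by
    rw [← hyz, map_add, pow_sub_smul_one_apply_of_eigen _ hUβ _ m, pow_sub_smul_one_apply_of_eigen _ hUα _ m,
      sub_self, zero_pow hmpos.ne', zero_smul, zero_add, smul_eq_zero] at hm
    exact hm.resolve_left (pow_ne_zero _ (sub_ne_zero.mpr (Ne.symm hne)))
  have hk₁ : k = Sβ w₁ := by rw [← hyz, hSα0, add_zero]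
  -- `w₁` is a generalised eigenvector for the eigencharacter of `G` at level `N`
  have hw₁ev : ∀ p : ℕ, (hp : p.Prime) → ∃ n : ℕ,
      (haveI : NeZero p := ⟨hp.ne_zero⟩;
        ((heckeT (Gamma0 N) 2 p - heckeEigenvalue G p • (1 : Module.End ℂ (CuspForm (Gamma0 N) 2))) ^ n) w₁) =
        0 := by
    intro p hp
    haveI : NeZero p := ⟨hp.ne_zero⟩
    have hevG : heckeEigenvalue G p = cuspCoeff G p :=
      heckeEigenvalue_eq_coeff_of_isNormalized hGnorm hp (hGeig p hp)
    by_cases hpℓ : p = ℓ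
    · subst hpℓ
      refine ⟨1, ?_⟩
      rw [pow_one, LinearMap.sub_apply, LinearMap.smul_apply, Module.End.one_apply, hV.mp hw₁, hevG, sub_self]
    · obtain ⟨n, hn⟩ := hk p hp
      rw [hev hp, if_neg hpℓ, hk₁, ← hevG,
        pow_sub_smul_one_apply_comm Sβ (heckeT (Gamma0 N) 2 p) (heckeT (Gamma0 (N * ℓ)) 2 p)
          (fun v ↦ heckeT_stab_comm h1 hℓℓ hℓ hp hpℓ v β) (heckeEigenvalue G p) n w₁, hSβv] at hn
      exact ⟨n, eq_zero_of_stab_eq_zero h1 hℓℓ hℓ _ β hn⟩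
  obtain ⟨c, hc⟩ := hGC w₁ hw₁ev
  exact ⟨c, by rw [hk₁, hc, map_smul]⟩

end Step

end Summit.BirchSwinnertonDyer.BirchSwinnertonDyer.Theorems.KimAtThreeDeepLowerOffStratumLevelLoweringMultiStabConditionOne

end
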